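import Literature.MathematicalPhysics.QuantumManyBody.CouplingPathArcChord
import HarnessLib

/-!
# Crux `CorrectorClosure` (stmt-AtomisticToContinuum-12058), line `llp-fidelity-arc` —
registered stub `stub_arcChord`

Supports (does not close) stmt-AtomisticToContinuum-12058, route `BECInsertionCorrector`.
The registered stub "arc ≥ chord for near-minimiser paths" of the lead's skeleton
`Cruxes/CorrectorClosure/Lines/llp-fidelity-arc.lean`, a specialisation of the Literature theorem
`fsAngle_endpoints_le_integral_of_local_speed_bound` (`CouplingPathArcChord.lean`: continuity
induction on `[0,1]` + the Fubini–Study triangle inequality `fsAngle_triangle` of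
`FubiniStudyAngle.lean`). The hypotheses `0 ≤ s` and `E_λ ≠ ⊤` of the registered signature are not
needed (near-minimisers exist at every node as soon as one tagged state exists).
-/

noncomputable section

open MeasureTheory
open scoped ENNReal

namespace Summit.AtomisticToContinuum.BoseEinsteinCondensation.Theorems.CorrectorClosure.LlpFidelityArc

open Literature.MathematicalPhysics.QuantumManyBody.BoseGas

/-- **Registered stub of line `llp-fidelity-arc` — arc ≥ chord.** If the near-minimiser path of the
coupled family `λ ↦ H_λ` on the torus has an integrable local Fubini–Study speed majorant `s` at every
node of `[0,1]` (for nearby nodes `λ' ≠ λ` some window `δ > 0` puts all `δ`-near-minimisers of `H_λ`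
and `H_{λ'}` within `d_FS ≤ ∫_{uIcc λ λ'} s`), then ONE window `δ > 0` puts every `δ`-near-minimiser
of `H₀` and every `δ`-near-minimiser of `H₁` within `d_FS ≤ ∫_{[0,1]} s`. [folklore] -/
theorem stub_arcChord :
    ∀ (v : ℝ → ℝ≥0∞) (N : ℕ) (L : ℝ) (s : ℝ → ℝ),
      IntegrableOn s (Set.Icc (0 : ℝ) 1) → (∀ t, 0 ≤ s t) →
      (∀ lam ∈ Set.Icc (0 : ℝ) 1, coupledGroundStateEnergy v lam N L ≠ ⊤) →
      (∀ lam ∈ Set.Icc (0 : ℝ) 1,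
        ∃ η : ℝ, 0 < η ∧ ∀ lam' ∈ Set.Icc (0 : ℝ) 1, lam' ≠ lam → |lam' - lam| < η →
          ∃ δ : ℝ≥0∞, 0 < δ ∧ ∀ Ψ Ψ' : TaggedPeriodicTrialState N L,
            coupledEnergy v lam Ψ ≤ coupledGroundStateEnergy v lam N L + δ →
            coupledEnergy v lam' Ψ' ≤ coupledGroundStateEnergy v lam' N L + δ →
              fsAngle Ψ Ψ' ≤ ∫ t in Set.uIcc lam lam', s t) →
      ∃ δ : ℝ≥0∞, 0 < δ ∧ ∀ Ψ₀ Ψ₁ : TaggedPeriodicTrialState N L,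
        coupledEnergy v 0 Ψ₀ ≤ coupledGroundStateEnergy v 0 N L + δ →
        coupledEnergy v 1 Ψ₁ ≤ coupledGroundStateEnergy v 1 N L + δ →
          fsAngle Ψ₀ Ψ₁ ≤ ∫ t in Set.Icc (0 : ℝ) 1, s t :=
  fun v N L s hs _ _ hloc => fsAngle_endpoints_le_integral_of_local_speed_bound v N L s hs hloc

end Summit.AtomisticToContinuum.BoseEinsteinCondensation.Theorems.CorrectorClosure.LlpFidelityArc

end
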